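import Summits.BirchSwinnertonDyer.BirchSwinnertonDyer.Theorems.ManinLocalTwoThreeShimuraThreeKernelLine
import Literature.NumberTheory.EllipticCurves.PAdicLFunctionFrickeSymmetryProofs
import Literature.NumberTheory.EllipticCurves.PAdicLFunctionNonvanishingProofs
import Literature.NumberTheory.EllipticCurves.CuspFormLFunctionNewformFrickeProofs
import Literature.NumberTheory.EllipticCurves.PeriodLatticeGamma1QuotientProofs
import Literature.NumberTheory.EllipticCurves.KuriharaNumberParityProofs
import HarnessLib

/-!
# FRICKE PARITY OF THE SHIMURA QUOTIENT: `(1 + ε_N)·Λ₀(f) ⊆ Λ₁(f)`; at `9 ∣ N` a Shimura `3`-kernel forces `ε_N = −1` (root number `+1`) — E-an-221 holds outright on the odd-sign half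
(route `ManinLocalTwoThree`, crux C3 `ManinPrimeToThreeAtNine` stmt-BirchSwinnertonDyer-22968; cell bsd-f2-manin, C3 LEAD p1 gen 17;
`--supports stmt-BirchSwinnertonDyer-22968`; node E-an-221 `ShimuraThreeTorsion.ShimuraThreeKernelForcesRationalThreeTorsionAtNine` — third habitat file after
`…ShimuraThreeTorsionCoprimeTotient` (p740101) and `…ShimuraThreeKernelLine` (p740531))

THE OBSERVATION (lead p1 g17; arithmetic shadow: the Fricke involution `w_N` normalises `Γ₁(N)` with `w_N⟨d⟩w_N⁻¹ = ⟨d⁻¹⟩`, so it acts on the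
Shimura subgroup `Σ(N)` by `−1`, while it acts on the optimal quotient `E₀ ⊂ J₀(N)` by the scalar `ε_N(f)`; hence `(ε_N + 1)·(E₀ ∩ Σ(N)) = 0`).
In the tree's lattice currency, for `f ∈ S₂(Γ₀(N))` with `f ∣ w_N = ε f`, `ε² = 1` (`IsFrickeEigen N f ε`):
for `γ = (a b; c d) ∈ Γ₀(N)` with `d > 0`, `c = N c₁`, Manin's relation at `r = 0` gives `{∞, γ∞}_f = {∞, b/d}_f − {∞, 0}_f` and, for
`δ = (a c₁; N b, d) ∈ Γ₀(N)` (same `d`!), `{∞, δ∞}_f = {∞, c₁/d}_f − {∞, 0}_f`; the tree's FRICKE FLIP (`IsFrickeEigen.modularSymbol_div_eq_neg_mul`,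
`a d − b N c₁ = 1`) says `{∞, b/d}_f = −ε {∞, c₁/d}_f` and `{∞, 0}_f = −ε {∞, 0}_f`; so `{∞, γ∞}_f = −ε {∞, δ∞}_f`, and since `d_γ = d_δ` the two
periods agree modulo `Λ₁(f)` (`cuspSymbol_sub_mem_periodLatticeGamma1_of_apply_eq`).  Therefore:

* §1 **`one_add_mul_mem_periodLatticeGamma1_of_isFrickeEigen`** — `(1 + ε)·z ∈ Λ₁(f)` for every `z ∈ Λ₀(f)`; in particular
  **`two_mul_mem_periodLatticeGamma1_of_isFrickeEigen_one`**: `ε = +1 ⟹ 2Λ₀(f) ⊆ Λ₁(f)` — the Shimura quotient `Λ₀(f)/Λ₁(f)` of a `w_N`-PLUS form is an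
  elementary `2`-group (at every level; no optimality, no curve);
* §2 at `9 ∣ N` (`3Λ₀ ⊆ Λ₁`, traceless `3`): **`periodLatticeGamma1_eq_of_isFrickeEigen_one_of_nine_dvd`** — `ε = +1 ⟹ Λ₁(f) = Λ₀(f)` (Stevens' curve = the
  optimal curve); **`not_kummerShimura_of_isFrickeEigen_one`**; **`frickeEigenvalue_eq_neg_one_of_kummerShimura`** — for the newform of an `X₀(N)`-datum
  (Atkin–Lehner: `w_N f = ε(f) f`, `ε(f) = ±1`, tree theorems `IsNewform0.frickeInvolution_eq_smul_holds` / `…eq_one_or_eq_neg_one_holds`) a Kummer–Shimura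
  third-period forces `ε(f) = −1`; **`rootNumber_eq_one_of_kummerShimura`** — at the conductor level, root number `w(W) = −ε(f) = +1` (EVEN functional-equation
  sign): NO Shimura `3`-kernel on any optimal curve of odd analytic-rank parity;
* §3 **E-an-221 HOLDS OUTRIGHT whenever `ε(f) = +1`** (`…_of_frickeEigenvalue_eq_one`, vacuously) and the STUB CUT **`…_of_frickeMinus`**: E-an-221 follows from
  its restriction E-an-221‡ to `ε(f) = −1` ∧ `3 ∣ φ(N/3)` ∧ the pinned kernel shape (`Λ₁(f) = ℤ·(3u/c) + 3Λ₀(f)`, `ū + u ∈ Λ_E`).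
  Census consistency: every known odd-index Shimura quotient (11a, 14a, 19a, 26b, 27a, 35a, 37b, 54a, …) sits on a rank-`0` optimal curve (`ε = −1`); at
  `9 ∣ N ≤ 386` the index-`3` classes are exactly 27a1, 54a1 (ref1 §R182), both `w = +1`.

HONEST FRAMING.  Unconditional theorems about the tree's period lattices (§1 needs only `IsFrickeEigen`; §2–§3 use the tree's PROVED Atkin–Lehner theory for
newforms).  They settle E-an-221 only where its hypothesis is contradictory (the `ε = +1` half); E-an-221 on the `ε = −1` half, RES₃♭, C3, Manin's conjecture and
BSD are NOT proved.  No definitions, no named facts, no sorry.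
[cite: AtkinLehner1970, §2 and Thm. 3 (w_N f = ±f for newforms)] [cite: Manin1972, Prop. 1.4 / Thm. 1.6 (Manin relation)]
[cite: LingOesterle1991, §1, Thm. 1 (shape: Σ(N) and the diamond operators)] [cite: MazurTateTeitelbaum1986Invent, §I.17 (the Fricke flip of modular symbols)]
-/

set_option autoImplicit false
-- lint-debt: the directory name repeats the summit name (sibling precedent `ManinLocalTwoThreeShimuraThreeKernelLine.lean`)
set_option linter.dupNamespace false

noncomputable section

open scoped Classical ComplexConjugate MatrixGroups ModularForm PeriodPair
open CongruenceSubgroup Complex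
open WeierstrassCurve Literature.NumberTheory.EllipticCurves Literature.NumberTheory.EllipticCurves.ModularForms
open Summit.BirchSwinnertonDyer.Rank1Residual.ManinAdditive.CuspidalKummer
open Summit.BirchSwinnertonDyer.Rank1Residual.ManinAdditive.CuspidalKummerThree
open Summit.BirchSwinnertonDyer.Rank1Residual.ManinAdditive.UDCKummerLine
open Summit.BirchSwinnertonDyer.Rank1Residual.ManinAdditive.UDCKummerLineK
open Summit.BirchSwinnertonDyer.Rank1Residual.ManinAdditive.ShimuraThreeTorsion

namespace Summit.BirchSwinnertonDyer.BirchSwinnertonDyer.Theorems.ManinLocalTwoThree.SigmaHabitat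

/-! ## §1 Fricke parity: `(1 + ε)·Λ₀(f) ⊆ Λ₁(f)` -/

section Fricke

variable {N : ℕ} [NeZero N] (f : CuspForm (Gamma0 N) 2)

/-- Manin's relation at `r = 0`: `{∞, b/d}_f = {∞, γ∞}_f + {∞, 0}_f` for `γ = (a b; c d) ∈ Γ₀(N)` with `d ≠ 0`. [cite: Manin1972, Prop. 1.4 / Thm. 1.6] -/
theorem modularSymbol_div_eq_cuspSymbol_add (γ : Gamma0 N) (hd : ((γ : SL(2, ℤ)) 1 1 : ℤ) ≠ 0) :
    modularSymbol f ((((γ : SL(2, ℤ)) 0 1 : ℤ) : ℚ) / (((γ : SL(2, ℤ)) 1 1 : ℤ) : ℚ)) = cuspSymbol f γ + modularSymbol f 0 := by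
  have hd' : (((γ : SL(2, ℤ)) 1 1 : ℤ) : ℚ) ≠ 0 := by exact_mod_cast hd
  have h := modularSymbol_gamma0_smul_holds f γ 0 (by rw [mul_zero, zero_add]; exact hd')
  simpa only [mul_zero, zero_add] using h

/-- **`(1 + ε)·{∞, 0}_f = 0`** (the Fricke flip at `m = 1`; so `{∞, 0}_f = 0`, i.e. `L(f, 1) = 0`, for a `w_N`-plus form).
[cite: MazurTateTeitelbaum1986Invent, §I.17] -/
theorem one_add_mul_modularSymbol_zero_eq_zero {ε : ℂ} (hW : IsFrickeEigen N f ε) (hε : ε ^ 2 = 1) :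
    (1 + ε) * modularSymbol f 0 = 0 := by
  have h := hW.modularSymbol_div_eq_neg_mul hε (m := 1) one_pos (a := 1) (u := 0) (v := 0) (by ring)
  simp only [Int.cast_zero, Nat.cast_one, zero_div] at h
  linear_combination h

/-- **THE FRICKE COMPANION.**  For `f ∣ w_N = ε f` (`ε² = 1`) and `γ = (a b; N c₁, d) ∈ Γ₀(N)` with `d > 0`, the matrix `δ = (a c₁; N b, d) ∈ Γ₀(N)`
has the SAME lower-right entry and `{∞, γ∞}_f = −ε·{∞, δ∞}_f` (Manin at `r = 0` for both, and the Fricke flips `{∞, b/d} = −ε{∞, c₁/d}`,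
`(1 + ε){∞, 0} = 0`). [cite: Manin1972, Prop. 1.4 / Thm. 1.6] [cite: MazurTateTeitelbaum1986Invent, §I.17] -/
theorem exists_companion_cuspSymbol_eq_neg_mul {ε : ℂ} (hW : IsFrickeEigen N f ε) (hε : ε ^ 2 = 1)
    (γ : Gamma0 N) (hd : 0 < ((γ : SL(2, ℤ)) 1 1 : ℤ)) :
    ∃ δ : Gamma0 N, ((δ : SL(2, ℤ)) 1 1 : ℤ) = ((γ : SL(2, ℤ)) 1 1 : ℤ) ∧ cuspSymbol f γ = -ε * cuspSymbol f δ := by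
  -- entries
  set a : ℤ := (γ : SL(2, ℤ)) 0 0 with ha
  set b : ℤ := (γ : SL(2, ℤ)) 0 1 with hb
  set c : ℤ := (γ : SL(2, ℤ)) 1 0 with hc
  set d : ℤ := (γ : SL(2, ℤ)) 1 1 with hdd
  have hdet : a * d - b * c = 1 := by
    have h := Matrix.det_fin_two (γ : SL(2, ℤ)).1
    rw [Matrix.SpecialLinearGroup.det_coe] at h
    linear_combination -h
  have hc0 : ((c : ℤ) : ZMod N) = 0 := Gamma0_mem.mp γ.2
  obtain ⟨c₁, hc₁⟩ : (N : ℤ) ∣ c := (ZMod.intCast_zmod_eq_zero_iff_dvd _ N).mp hc0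
  -- the companion `δ = (a c₁; N b, d)`
  let M : SL(2, ℤ) := ⟨!![a, c₁; (N : ℤ) * b, d], by
    rw [Matrix.det_fin_two_of]; rw [hc₁] at hdet; linear_combination hdet⟩
  have hM : M ∈ Gamma0 N := by
    rw [Gamma0_mem]
    simp only [M, Matrix.of_apply, Matrix.cons_val', Matrix.cons_val_zero, Matrix.cons_val_one, Matrix.cons_val_fin_one]
    push_cast
    simp
  have hδ11 : (((⟨M, hM⟩ : Gamma0 N) : SL(2, ℤ)) 1 1 : ℤ) = d := by
    simp only [M, Matrix.of_apply, Matrix.cons_val', Matrix.cons_val_one, Matrix.cons_val_fin_one]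
  have hδ01 : (((⟨M, hM⟩ : Gamma0 N) : SL(2, ℤ)) 0 1 : ℤ) = c₁ := by
    simp only [M, Matrix.of_apply, Matrix.cons_val', Matrix.cons_val_zero, Matrix.cons_val_one, Matrix.cons_val_fin_one]
  refine ⟨⟨M, hM⟩, hδ11, ?_⟩
  have hdne : d ≠ 0 := ne_of_gt hd
  -- Manin at `r = 0` for `γ` and `δ`
  have hγ0 : modularSymbol f ((b : ℚ) / d) = cuspSymbol f γ + modularSymbol f 0 :=
    modularSymbol_div_eq_cuspSymbol_add f γ hdne
  have hδ0 : modularSymbol f ((c₁ : ℚ) / d) = cuspSymbol f ⟨M, hM⟩ + modularSymbol f 0 := by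
    have h := modularSymbol_div_eq_cuspSymbol_add f ⟨M, hM⟩ (by rw [hδ11]; exact hdne)
    rwa [hδ11, hδ01] at h
  -- the Fricke flip `{∞, b/d} = −ε {∞, c₁/d}` (`a·d − b·N·c₁ = 1`)
  obtain ⟨m, hm⟩ : ∃ m : ℕ, (m : ℤ) = d := ⟨d.toNat, Int.toNat_of_nonneg hd.le⟩
  have hm0 : 0 < m := by
    have h : (0 : ℤ) < m := hm ▸ hd
    exact_mod_cast h
  have huv : a * m - b * (N * c₁) = 1 := by rw [hm, ← hc₁]; exact hdet
  have hflip := hW.modularSymbol_div_eq_neg_mul hε hm0 huv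
  have hmq : ((m : ℕ) : ℚ) = (d : ℚ) := by exact_mod_cast hm
  rw [hmq, hγ0, hδ0] at hflip
  have h0 := one_add_mul_modularSymbol_zero_eq_zero f hW hε
  linear_combination hflip - h0

/-- **FRICKE PARITY OF THE SHIMURA QUOTIENT (UNCONDITIONAL): `w_N f = f ⟹ 2·{∞, γ∞}_f ∈ Λ₁(f)`** for every `γ ∈ Γ₀(N)` — the Shimura quotient
`Λ₀(f)/Λ₁(f)` of a `w_N`-plus form is an elementary `2`-group.  (WLOG `d_γ > 0`: `−γ` has the same period, and `d_γ = 0` forces `N = 1`.)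
[cite: AtkinLehner1970, §2] [cite: Manin1972, Prop. 1.4 / Thm. 1.6] -/
theorem two_mul_cuspSymbol_mem_periodLatticeGamma1_of_isFrickeEigen_one (hW : IsFrickeEigen N f 1) (γ : Gamma0 N) :
    2 * cuspSymbol f γ ∈ periodLatticeGamma1 f := by
  -- WLOG the lower-right entry is positive
  suffices key : ∀ γ : Gamma0 N, 0 < ((γ : SL(2, ℤ)) 1 1 : ℤ) → 2 * cuspSymbol f γ ∈ periodLatticeGamma1 f by
    rcases lt_trichotomy 0 ((γ : SL(2, ℤ)) 1 1 : ℤ) with hpos | hzero | hneg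
    · exact key γ hpos
    · -- `d = 0` forces `N = 1` (`−bc = 1`, `N ∣ c`), where `Γ₁(N) = Γ₀(N)`
      have hdet := Matrix.det_fin_two (γ : SL(2, ℤ)).1
      rw [Matrix.SpecialLinearGroup.det_coe, ← hzero, mul_zero, zero_sub] at hdet
      have hc0 : ((((γ : SL(2, ℤ)) 1 0 : ℤ)) : ZMod N) = 0 := Gamma0_mem.mp γ.2
      have hNc : (N : ℤ) ∣ ((γ : SL(2, ℤ)) 1 0 : ℤ) := (ZMod.intCast_zmod_eq_zero_iff_dvd _ N).mp hc0
      have h1 : (N : ℤ) ∣ 1 := hNc.trans ⟨-((γ : SL(2, ℤ)) 0 1 : ℤ), by linear_combination hdet⟩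
      have hN1 : N = 1 := by
        have := Int.eq_one_of_dvd_one (by positivity) h1
        exact_mod_cast this
      subst hN1
      have hmem : (γ : SL(2, ℤ)) ∈ Gamma1 1 := by
        rw [Gamma1_mem]
        exact ⟨Subsingleton.elim _ _, Subsingleton.elim _ _, Subsingleton.elim _ _⟩
      have h := cuspSymbol_mem_periodLatticeGamma1 f ⟨(γ : SL(2, ℤ)), hmem⟩
      rw [two_mul]
      exact add_mem h h
    · obtain ⟨γ', -, -, h11, hγ'⟩ := exists_neg_entries_cuspSymbol_eq f γ
      rw [← hγ']
      exact key γ' (by rw [h11]; linarith)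
  intro γ hd
  obtain ⟨δ, hδ11, hγδ⟩ := exists_companion_cuspSymbol_eq_neg_mul f hW (by norm_num) γ hd
  have hsame : cuspSymbol f δ - cuspSymbol f γ ∈ periodLatticeGamma1 f :=
    cuspSymbol_sub_mem_periodLatticeGamma1_of_apply_eq f γ δ (by rw [hδ11])
  have key : 2 * cuspSymbol f γ = -(cuspSymbol f δ - cuspSymbol f γ) := by linear_combination hγδ
  rw [key]
  exact neg_mem hsame

/-- **`w_N f = f ⟹ 2Λ₀(f) ⊆ Λ₁(f)`** (lattice form). [cite: AtkinLehner1970, §2] -/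
theorem two_mul_mem_periodLatticeGamma1_of_isFrickeEigen_one (hW : IsFrickeEigen N f 1) {z : ℂ} (hz : z ∈ periodLattice f) :
    2 * z ∈ periodLatticeGamma1 f := by
  have hz' : z ∈ (periodLattice f : Set ℂ) := hz
  rw [coe_periodLattice_eq_range] at hz'
  obtain ⟨γ, rfl⟩ := hz'
  exact two_mul_cuspSymbol_mem_periodLatticeGamma1_of_isFrickeEigen_one f hW γ

end Fricke

/-! ## §2 At `9 ∣ N`: a `w_N`-plus newform has `Λ₁(f) = Λ₀(f)`; a Shimura third-period forces `ε(f) = −1`, root number `+1` -/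

section Nine

variable {W : WeierstrassCurve ℚ} {N : ℕ} [NeZero N]

/-- **`w_N f = f` and `9 ∣ N` ⟹ `Λ₁(f) = Λ₀(f)`** (`2Λ₀ ⊆ Λ₁` by Fricke parity and `3Λ₀ ⊆ Λ₁` by the traceless prime `3`; `z = 3z − 2z`).
[cite: AtkinLehner1970, §2] [cite: LingOesterle1991, Thm. 6 (shape)] -/
theorem periodLatticeGamma1_eq_of_isFrickeEigen_one_of_nine_dvd (D : ModularParametrizationData W N) (h9 : 3 ^ 2 ∣ N)
    (hW : IsFrickeEigen N D.f 1) : periodLatticeGamma1 D.f = periodLattice D.f := by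
  refine le_antisymm (periodLatticeGamma1_le_periodLattice D.f) fun z hz ↦ ?_
  have h2 := two_mul_mem_periodLatticeGamma1_of_isFrickeEigen_one D.f hW hz
  have h3 := three_mul_mem_periodLatticeGamma1_of_nine_dvd D h9 hz
  have he : z = 3 * z - 2 * z := by ring
  rw [he]
  exact sub_mem h3 h2

/-- **No Shimura third-period for a `w_N`-plus newform at `9 ∣ N`** (lattice-optimal datum; every `u` with `3u ∈ Λ_E`). [cite: AtkinLehner1970, §2] -/
theorem not_kummerShimura_of_isFrickeEigen_one (D : ModularParametrizationData W N)
    (hopt : ∀ z ∈ D.L.lattice, ∃ w ∈ periodLattice D.f, z = D.c * w) (h9 : 3 ^ 2 ∣ N)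
    (hW : IsFrickeEigen N D.f 1) {u : ℂ} (hu₂ : 3 * u ∈ D.L.lattice) : ¬ KummerShimura D u :=
  not_kummerShimura_of_periodLatticeGamma1_eq D hopt (periodLatticeGamma1_eq_of_isFrickeEigen_one_of_nine_dvd D h9 hW) hu₂

/-- The newform of an `X₀(N)`-datum is a `w_N`-eigenform with eigenvalue `ε(f) = frickeEigenvalue f ∈ {±1}` (Atkin–Lehner; tree theorems
`IsNewform0.frickeInvolution_eq_smul_holds`, `isFrickeEigen_of_frickeInvolution_eq_smul`). [cite: AtkinLehner1970, Thm. 3] -/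
theorem isFrickeEigen_frickeEigenvalue (D : ModularParametrizationData W N) : IsFrickeEigen N D.f (frickeEigenvalue D.f) :=
  isFrickeEigen_of_frickeInvolution_eq_smul N (IsNewform0.frickeInvolution_eq_smul_holds D.isNewformOf.1)

/-- **A Shimura third-period forces `ε(f) = −1`** (`9 ∣ N`, lattice-optimal): `frickeEigenvalue D.f = −1`. [cite: AtkinLehner1970, Thm. 3] -/
theorem frickeEigenvalue_eq_neg_one_of_kummerShimura (D : ModularParametrizationData W N)
    (hopt : ∀ z ∈ D.L.lattice, ∃ w ∈ periodLattice D.f, z = D.c * w) (h9 : 3 ^ 2 ∣ N)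
    {u : ℂ} (hu₂ : 3 * u ∈ D.L.lattice) (hS : KummerShimura D u) : frickeEigenvalue D.f = -1 := by
  rcases IsNewform0.frickeEigenvalue_eq_one_or_eq_neg_one_holds D.isNewformOf.1 with h1 | h1
  · exfalso
    have hW := isFrickeEigen_frickeEigenvalue D
    rw [h1] at hW
    exact not_kummerShimura_of_isFrickeEigen_one D hopt h9 hW hu₂ hS
  · exact h1

/-- **At the conductor level: a Shimura third-period forces root number `w(W) = +1`** (even functional-equation sign; `w(W) = −ε(f)`, tree theorem
`IsNewformOf.isFrickeEigen_neg_rootNumber`).  So E-an-221's habitat excludes every optimal curve of odd analytic-rank parity. [cite: AtkinLehner1970, Thm. 3] -/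
theorem rootNumber_eq_one_of_kummerShimura [W.IsElliptic] [NeZero (W.conductorNorm ℤ)]
    (D : ModularParametrizationData W (W.conductorNorm ℤ))
    (hopt : ∀ z ∈ D.L.lattice, ∃ w ∈ periodLattice D.f, z = D.c * w) (h9 : 3 ^ 2 ∣ W.conductorNorm ℤ)
    {u : ℂ} (hu₂ : 3 * u ∈ D.L.lattice) (hS : KummerShimura D u) : W.rootNumber = 1 := by
  rcases W.rootNumber_eq_one_or with h | h
  · exact h
  · exfalso
    have hW := D.isNewformOf.isFrickeEigen_neg_rootNumber
    rw [h] at hW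
    norm_num at hW
    exact not_kummerShimura_of_isFrickeEigen_one D hopt h9 hW hu₂ hS

end Nine

/-! ## §3 E-an-221 on the `ε = +1` half, and the stub cut E-an-221 ⟸ E-an-221‡ -/

/-- **E-an-221 HOLDS OUTRIGHT for `w_N`-plus newforms** (`frickeEigenvalue D.f = 1`; vacuously). [cite: AtkinLehner1970, Thm. 3] -/
theorem shimuraThreeKernelForcesRationalThreeTorsionAtNine_of_frickeEigenvalue_eq_one
    (W : WeierstrassCurve ℚ) [W.IsElliptic] [W.IsGloballyMinimal] {N : ℕ} [NeZero N]
    (D : ModularParametrizationData W N)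
    (hopt : ∀ z ∈ D.L.lattice, ∃ w ∈ periodLattice D.f, z = D.c * w) (h9 : 3 ^ 2 ∣ N)
    (hε : frickeEigenvalue D.f = 1) (u : ℂ) (hu₂ : 3 * u ∈ D.L.lattice) (hS : KummerShimura D u) :
    ∃ X Y : ℚ, IsShortThreeTorsion W D.c X Y := by
  have h := frickeEigenvalue_eq_neg_one_of_kummerShimura D hopt h9 hu₂ hS
  rw [hε] at h
  norm_num at h

/-- **THE STUB CUT: E-an-221 ⟸ E-an-221‡**, where E-an-221‡ is E-an-221 restricted to `frickeEigenvalue D.f = −1` (root number `+1`), `3 ∣ φ(N/3)`, and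
the pinned kernel shape `Λ₁(f) = ℤ·(3u/c) + 3Λ₀(f)`, `ū + u ∈ Λ_E`.  The C3 skeleton may carry the ‡-form. [cite: AtkinLehner1970, Thm. 3] -/
theorem shimuraThreeKernelForcesRationalThreeTorsionAtNine_of_frickeMinus
    (h : ∀ (W : WeierstrassCurve ℚ) [W.IsElliptic] [W.IsGloballyMinimal] {N : ℕ} [NeZero N]
      (D : ModularParametrizationData W N),
      (∀ z ∈ D.L.lattice, ∃ w ∈ periodLattice D.f, z = D.c * w) → 3 ^ 2 ∣ N → frickeEigenvalue D.f = -1 → 3 ∣ Nat.totient (N / 3) →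
      ∀ u : ℂ, 3 * u ∈ D.L.lattice →
      (∀ z : ℂ, z ∈ periodLatticeGamma1 D.f ↔ ∃ k : ℤ, ∃ v ∈ periodLattice D.f, z = k * (3 * u / D.c) + 3 * v) →
      conj u + u ∈ D.L.lattice →
      ∃ X Y : ℚ, IsShortThreeTorsion W D.c X Y) :
    ShimuraThreeKernelForcesRationalThreeTorsionAtNine :=
  fun W _ _ _ _ D hopt h9 u _ hu₂ hS ↦
    h W D hopt h9 (frickeEigenvalue_eq_neg_one_of_kummerShimura D hopt h9 hu₂ hS)
      (three_dvd_totient_div_three_of_kummerShimura D hopt h9 hu₂ hS) u hu₂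
      (mem_periodLatticeGamma1_iff_of_kummerShimura D hopt h9 hu₂ hS) (conj_add_self_mem_lattice_of_kummerShimura D hopt h9 hu₂ hS)



end Summit.BirchSwinnertonDyer.BirchSwinnertonDyer.Theorems.ManinLocalTwoThree.SigmaHabitat

end
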